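import Mathlib.Algebra.Order.Floor.Ring
import Mathlib.Logic.Equiv.Defs
import Literature.Probability.LatticeModels.ScalingLimit
import HarnessLib

/-!
# The brickwork map: a discretised rotation about the vertical axis by two lattice shears

Topic `Literature/Probability/LatticeModels`; requested (definition item `defn-brickworkMap`) by
route `CriticalPhenomena/VolterraWard` (summit `Ising3DConformalLimit`), whose lattice cruxes
`TwistFluxConservation`, `CoreTransparency`, `WallCrossingContinuity`, `WallDecay`
(stmt-CriticalPhenomena-7037–7040) inline it verbatim as
`let F : ℕ → ℤ → Site 3 → Site 3 := fun W M p i => if i = 0 then p 0 - M * (p 1 / (W : ℤ)) else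
  if i = 1 then p 1 + M * ((p 0 - M * (p 1 / (W : ℤ))) / (W : ℤ)) else p 2`
(`brickworkMap_eq` records that `F W M = brickworkMap W M` definitionally).

`brickworkMap W M : ℤ³ → ℤ³`, `p ↦ (p₀ − M k, p₁ + M j, p₂)` with `k = p₁ / W` and
`j = (p₀ − M k) / W` (integer division by the block size `W`, i.e. FLOOR division for `W > 0`,
`Int.ediv`), is the composition `shearY W M ∘ shearX W M` of two staircase shears of `ℤ³`
(`shearX : p ↦ (p₀ − M (p₁ / W), p₁, p₂)`, `shearY : q ↦ (q₀, q₁ + M (q₀ / W), q₂)`): an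
area-preserving, height-preserving bijection of `ℤ³` (`brickworkEquiv`, inverse `brickworkInv`),
the identity for `M = 0`, which on the blocks of the staggered ("brickwork") grid of side `W` is a
translation — the lattice realisation of the rotation by the angle `ε ≈ M/W` about the vertical
axis used by the route (a twist boundary realised by two arrays of screw dislocations with Burgers
vector `M` and spacing `W`, Frank's formula `θ ≈ b/s`; Cai–Nix, *Imperfections in crystalline
solids* (2016), §14.2). Its continuum companion `brickworkMapCont W M δ : ℝ³ → ℝ³`,
`v ↦ v + Mδ·(−k, j, 0)` with `k = ⌊v₁/(Wδ)⌋`, `j = ⌊(v₀ − Mδk)/(Wδ)⌋`, INTERTWINES the lattice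
approximation `[·/δ]` EXACTLY: `brickworkMap W M [v/δ] = [brickworkMapCont W M δ v / δ]`
(`brickworkMap_latticeApprox`, from the floor identity `⌊⌊t⌋/W⌋ = ⌊t/W⌋`,
`Int.floor_div_natCast`) — the identity used by the route's glue item `VolterraGlue`
(stmt-CriticalPhenomena-7041).

## Contents (all proved)

* `brickworkMap`, `brickworkMap_eq` (agreement with the route's `F`, `rfl`), coordinate lemmas;
* `shearX`, `shearY`, `brickworkMap_eq_shearY_comp_shearX`;
* `brickworkInv`, `brickworkInv_brickworkMap`, `brickworkMap_brickworkInv`,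
  `brickworkMap_bijective`, `brickworkEquiv`;
* `brickworkMap_zero` (`M = 0` is the identity), `brickworkMap_apply_two` (heights are preserved);
* `brickworkMapCont`, `brickworkMap_latticeApprox` (exactness), `brickworkMapCont_zero`.

## References

* [CaiNix2016] W. Cai, W. D. Nix, *Imperfections in Crystalline Solids*, CUP (2016), §14.2 (twist
  boundaries as crossed grids of screw dislocations; Frank's formula).
* Route `CriticalPhenomena/VolterraWard`, rationale (E1) (the map `F`).
-/

noncomputable section

namespace Literature.Probability.LatticeModels

/-! ### The map and its coordinates -/

/-- The **brickwork map** `F_{W,M} : ℤ³ → ℤ³`, `p ↦ (p₀ − M k, p₁ + M j, p₂)` with `k = p₁ / W`,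
`j = (p₀ − M k) / W` (integer floor division by the block size `W`): the discretised rotation by
`≈ M/W` about the vertical axis of route `VolterraWard`, verbatim its inlined `F W M`
(`brickworkMap_eq`). [cite: CaiNix2016, §14.2] -/
def brickworkMap (W : ℕ) (M : ℤ) (p : Site 3) : Site 3 :=
  fun i => if i = 0 then p 0 - M * (p 1 / (W : ℤ)) else
    if i = 1 then p 1 + M * ((p 0 - M * (p 1 / (W : ℤ))) / (W : ℤ)) else p 2

/-- **Agreement with the route**: the `let F` of the cruxes of route `VolterraWard` IS
`brickworkMap` (definitionally), so those items can be restated over `brickworkMap` without change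
of meaning. [folklore] -/
theorem brickworkMap_eq :
    (fun (W : ℕ) (M : ℤ) (p : Site 3) (i : Fin 3) => if i = 0 then p 0 - M * (p 1 / (W : ℤ)) else
      if i = 1 then p 1 + M * ((p 0 - M * (p 1 / (W : ℤ))) / (W : ℤ)) else p 2) = brickworkMap :=
  rfl

variable (W : ℕ) (M : ℤ)

/-- First coordinate: `p₀ − M (p₁ / W)`. [folklore] -/
@[simp] theorem brickworkMap_apply_zero (p : Site 3) :
    brickworkMap W M p 0 = p 0 - M * (p 1 / (W : ℤ)) := rfl

/-- Second coordinate: `p₁ + M ((p₀ − M (p₁ / W)) / W)`. [folklore] -/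
@[simp] theorem brickworkMap_apply_one (p : Site 3) :
    brickworkMap W M p 1 = p 1 + M * ((p 0 - M * (p 1 / (W : ℤ))) / (W : ℤ)) := rfl

/-- Third coordinate (height) is unchanged. [folklore] -/
@[simp] theorem brickworkMap_apply_two (p : Site 3) : brickworkMap W M p 2 = p 2 := rfl

/-- `M = 0`: the brickwork map is the identity. [folklore] -/
@[simp] theorem brickworkMap_zero (W : ℕ) (p : Site 3) : brickworkMap W 0 p = p := by
  funext i
  fin_cases i <;> simp [brickworkMap]

/-! ### Two shears -/

/-- The staircase shear `p ↦ (p₀ − M (p₁ / W), p₁, p₂)` (slide the rows `p₁ ∈ [kW, (k+1)W)` by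
`−M k` in the `x`-direction). [folklore] -/
def shearX (p : Site 3) : Site 3 :=
  fun i => if i = 0 then p 0 - M * (p 1 / (W : ℤ)) else p i

/-- The staircase shear `q ↦ (q₀, q₁ + M (q₀ / W), q₂)` (slide the columns `q₀ ∈ [jW, (j+1)W)` by
`+M j` in the `y`-direction). [folklore] -/
def shearY (q : Site 3) : Site 3 :=
  fun i => if i = 1 then q 1 + M * (q 0 / (W : ℤ)) else q i

/-- The brickwork map is `shearY ∘ shearX`. [folklore] -/
theorem brickworkMap_eq_shearY_comp_shearX : brickworkMap W M = shearY W M ∘ shearX W M := by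
  funext p i
  fin_cases i <;> simp [brickworkMap, shearX, shearY]

/-! ### Inverse and bijectivity -/

/-- The inverse brickwork map `r ↦ (r₀ + M ((r₁ − M (r₀ / W)) / W), r₁ − M (r₀ / W), r₂)`
(undo `shearY`, then `shearX`). [folklore] -/
def brickworkInv (r : Site 3) : Site 3 :=
  fun i => if i = 0 then r 0 + M * ((r 1 - M * (r 0 / (W : ℤ))) / (W : ℤ)) else
    if i = 1 then r 1 - M * (r 0 / (W : ℤ)) else r 2

/-- `brickworkInv` is a left inverse of `brickworkMap`. [folklore] -/
theorem brickworkInv_brickworkMap (p : Site 3) : brickworkInv W M (brickworkMap W M p) = p := by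
  funext i
  fin_cases i
  · simp [brickworkInv, brickworkMap]
  · simp [brickworkInv, brickworkMap]
  · simp [brickworkInv, brickworkMap]

/-- `brickworkInv` is a right inverse of `brickworkMap`. [folklore] -/
theorem brickworkMap_brickworkInv (r : Site 3) : brickworkMap W M (brickworkInv W M r) = r := by
  funext i
  fin_cases i
  · simp [brickworkInv, brickworkMap]
  · simp [brickworkInv, brickworkMap]
  · simp [brickworkInv, brickworkMap]

/-- The brickwork map as a permutation of `ℤ³`. [folklore] -/
def brickworkEquiv : Site 3 ≃ Site 3 where
  toFun := brickworkMap W M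
  invFun := brickworkInv W M
  left_inv := brickworkInv_brickworkMap W M
  right_inv := brickworkMap_brickworkInv W M

/-- `brickworkEquiv` is `brickworkMap` as a function. [folklore] -/
@[simp] theorem coe_brickworkEquiv : ⇑(brickworkEquiv W M) = brickworkMap W M := rfl

/-- The brickwork map is a bijection of `ℤ³` (area preserving: a composition of shears).
[folklore] -/
theorem brickworkMap_bijective : Function.Bijective (brickworkMap W M) :=
  (brickworkEquiv W M).bijective

/-- The brickwork map is injective. [folklore] -/
theorem brickworkMap_injective : Function.Injective (brickworkMap W M) :=
  (brickworkMap_bijective W M).1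

/-! ### The continuum companion and the exact intertwining with `[·/δ]` -/

/-- The **continuum brickwork map** at mesh `δ`: `v ↦ v + Mδ·(−k, j, 0)` with
`k = ⌊v₁/(Wδ)⌋`, `j = ⌊(v₀ − Mδk)/(Wδ)⌋` — a translation on each brick of the staggered grid of
side `Wδ`, intertwining the lattice approximation exactly (`brickworkMap_latticeApprox`); as
`W δ → 0` with `M/W → ε` it is the rotation by `ε` about the vertical axis up to `O(Wδ)`.
[cite: CaiNix2016, §14.2] -/
def brickworkMapCont (δ : ℝ) (v : EuclideanSpace ℝ (Fin 3)) : EuclideanSpace ℝ (Fin 3) :=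
  v + ((M : ℝ) * δ) • WithLp.toLp 2
    ![-(⌊v 1 / ((W : ℝ) * δ)⌋ : ℝ),
      (⌊(v 0 - (M : ℝ) * δ * (⌊v 1 / ((W : ℝ) * δ)⌋ : ℝ)) / ((W : ℝ) * δ)⌋ : ℝ), 0]

/-- `M = 0`: the continuum brickwork map is the identity. [folklore] -/
@[simp] theorem brickworkMapCont_zero (W : ℕ) (δ : ℝ) (v : EuclideanSpace ℝ (Fin 3)) :
    brickworkMapCont W 0 δ v = v := by
  simp [brickworkMapCont]

variable {W M}

/-- The block index of the lattice approximation is the block index of the point: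
`⌊v/δ⌋ / W = ⌊v/(Wδ)⌋` (`Int.floor_div_natCast`). [folklore] -/
theorem floor_div_ediv_natCast (t δ : ℝ) (W : ℕ) : ⌊t / δ⌋ / (W : ℤ) = ⌊t / ((W : ℝ) * δ)⌋ := by
  rw [← Int.floor_div_natCast, div_div, mul_comm]

/-- **Exact intertwining** (used by `VolterraGlue`, stmt-CriticalPhenomena-7041): for `δ > 0`,
`brickworkMap W M [v/δ] = [brickworkMapCont W M δ v / δ]` for every `v ∈ ℝ³` — the lattice map
on lattice approximations is the lattice approximation of a piecewise translation.
Coordinate `0`: `⌊v₀/δ⌋ − Mk = ⌊(v₀ − Mδk)/δ⌋`; coordinate `1`: `(⌊v₀/δ⌋ − Mk)/W = ⌊(v₀ − Mδk)/(Wδ)⌋ = j`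
and `⌊v₁/δ⌋ + Mj = ⌊(v₁ + Mδj)/δ⌋`; heights untouched. [folklore] -/
theorem brickworkMap_latticeApprox {δ : ℝ} (hδ : 0 < δ) (W : ℕ) (M : ℤ)
    (v : EuclideanSpace ℝ (Fin 3)) :
    brickworkMap W M (latticeApprox δ v) = latticeApprox δ (brickworkMapCont W M δ v) := by
  have hδ0 : δ ≠ 0 := hδ.ne'
  set k : ℤ := ⌊v 1 / ((W : ℝ) * δ)⌋ with hk
  set j : ℤ := ⌊(v 0 - (M : ℝ) * δ * (k : ℝ)) / ((W : ℝ) * δ)⌋ with hj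
  have hk' : ⌊v 1 / δ⌋ / (W : ℤ) = k := floor_div_ediv_natCast _ _ _
  -- coordinate 0 of both sides, as a real floor
  have h0 : (⌊v 0 / δ⌋ : ℤ) - M * k = ⌊(v 0 - (M : ℝ) * δ * (k : ℝ)) / δ⌋ := by
    rw [show (v 0 - (M : ℝ) * δ * (k : ℝ)) / δ = v 0 / δ - ((M * k : ℤ) : ℝ) by
      push_cast; field_simp]
    rw [Int.floor_sub_intCast]
  have hj' : (⌊v 0 / δ⌋ - M * k) / (W : ℤ) = j := by
    rw [h0, floor_div_ediv_natCast, hj]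
  funext i
  fin_cases i
  · -- coordinate 0
    simp only [brickworkMap, latticeApprox_apply, brickworkMapCont, Fin.zero_eta, Fin.isValue,
      ↓reduceIte, PiLp.add_apply, PiLp.smul_apply, Matrix.cons_val_zero, smul_eq_mul]
    rw [← hk, hk', h0]
    congr 1
    ring
  · -- coordinate 1
    simp only [brickworkMap, latticeApprox_apply, brickworkMapCont, Fin.mk_one, Fin.isValue,
      one_ne_zero, ↓reduceIte, PiLp.add_apply, PiLp.smul_apply,
      Matrix.cons_val_one, Matrix.cons_val_zero, smul_eq_mul]
    rw [← hk, ← hj, hk', hj']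
    rw [show (v 1 + (M : ℝ) * δ * (j : ℝ)) / δ = v 1 / δ + ((M * j : ℤ) : ℝ) by
      push_cast; field_simp]
    rw [Int.floor_add_intCast]
  · -- coordinate 2
    simp [brickworkMap, brickworkMapCont]

end Literature.Probability.LatticeModels

end
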